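import Literature.NumberTheory.LFunctions.NoRealZeroCertificateReplayTable19
import HarnessLib

/-!
# Kernel replay of the Lu–Zaman–Zhao certificates, heavy tier `19`, file 434: `399965 ≤ |D| ≤ 399965`

Topic `Literature/NumberTheory/LFunctions`. Pure kernel computation (`decide +kernel`, standard axioms):
1 HEAVY fundamental discriminants `D` (their Lu–Zaman–Zhao Table-1 certificate at `λ = 1.6`,
`c = 1/5` needs primes beyond `2^15`; this tier: largest prime needed in the table `table15_19`) are
certified individually by the row-list checker `checkListK` (`NoRealZeroCertificateReplayFast.lean`,
sound by `certifiedAt_of_checkListK` over `table15_19_valid`): for each listed `D`,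
`rhs (1/5) 1.6 0.22675 1.1614 |D| < ∑_{p ≤ N} (log p/(p^σ − 1) + (D/p) log p/(p^σ − (D/p)))` for an `N`
found by the kernel ((2.5) of arXiv:2602.03626 fails; with the printed Theorem 2.1 =
`LuZamanZhao2026.theorem21` this excludes zeros of `L(s, χ_D)` in `[1 − 1/(5 log |D|), 1]`).
1 evaluations (29338 prime terms), then `lzzHeavy19_434 : ∀ D ∈ rowsDK rows, CertifiedAt (1/5) D`
for the concatenated row list (rows as `(neg, |D|)`, `D = sgnD neg |D|`). Serves item
`ReplayedCertificates` / `HeavyRows` of route `LZZCertificateReplay` (`parity-realchar` cell).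

## References

* W. Lu, A. Zaman, K. Zhao, *Dirichlet L-functions of quadratic characters have no exceptional
  zeros for moduli up to 10¹⁰*, Math. Comp. (2026), arXiv:2602.03626, §2.1–§3, (2.3)–(2.5).
  [LuZamanZhao2026]
-/

namespace Literature.NumberTheory.LFunctions
namespace LuZamanZhao2026
namespace Replay

set_option maxHeartbeats 0 in
/-- Kernel evaluation: the 1 heavy rows `399965 ≤ |D| ≤ 399965` of this tier pass
`checkListK table15_19` (29338 prime terms). [cite: LuZamanZhao2026, §2.1–§3 and (2.5)] -/
theorem lzzHeavy19_434_c0 :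
    checkListK table15_19 [(false, 399965)] = true := by
  decide +kernel

set_option maxHeartbeats 0 in
/-- **Heavy tier `19`, file 434: the 1 listed heavy discriminants `399965 ≤ |D| ≤ 399965` are
certified** (`CertifiedAt (1/5) D` for every `D` of the concatenated row list). [cite: LuZamanZhao2026, §2.1–§3 and (2.5)] -/
theorem lzzHeavy19_434 :
    ∀ D ∈ rowsDK ([(false, 399965)]), CertifiedAt (1 / 5) D :=
  certifiedAt_of_mem_rowsDK table15_19_valid lzzHeavy19_434_c0

end Replay
end LuZamanZhao2026
end Literature.NumberTheory.LFunctions
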